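import Literature.NumberTheory.Sieve.BombieriFriedlanderIwaniecTheorem9Proofs
import Literature.NumberTheory.Sieve.BombieriFriedlanderIwaniecCaseA
import HarnessLib

/-!
# Bombieri–Friedlander–Iwaniec 1986, §16 for Theorem 9: Case I — Theorem 6 on the blocks

Topic `Literature/NumberTheory/Sieve`, sibling of
`Literature.NumberTheory.Sieve.BombieriFriedlanderIwaniecTheorem9Proofs`.  Everything here is
PROVED (from the named facts `BombieriFriedlanderIwaniecTheorem6` and
`BombieriFriedlanderIwaniecLemma3` of BFI 1986, taken as hypotheses); no named fact is introduced.

E. Bombieri, J. B. Friedlander, H. Iwaniec, *Primes in arithmetic progressions to large moduli*,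
Acta Math. 156 (1986), 203–251, §16 (p. 250), proof of Theorem 9: "The proof is much the same as
that of Theorem 8; the difference is that we appeal to Theorems 6 and 7* instead of 1, 2, 3, 4 and
5*.  Let `R = x^{θ₂}`, so `−∞ < θ₂ < 1/10`.  If (15.6) has a partial sum `λ` with
`θ₂ + ε < λ < (1−θ₂)/3 − ε` (16.1) then Theorem 6 is applicable."  This file is that appeal, for a
piece `α ⋆ β` of the sieved Heath-Brown decomposition (`Literature.NumberTheory.Sieve.BFI.bilinDisc`)
against the weights of Theorem 9 in its signed form (`γ_q = 1_{q ≤ Q, (q,a)=1}`, `|δ_r| ≤ 1` on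
`r ≤ R, (r,a)=1`), the analogue of `Literature.NumberTheory.Sieve.BFI.caseA1_bound` (§17, Theorem 1)
for Theorem 10:

* `BFI.pairSum_bilinDisc_eq_sum_dispD` — the signed pair sum as a double sum of dispersion sums
  `𝒟(M, N, Q/2^{k+1}, R/2^{k'+1})` (BFI (3.1)) with the (A₇)-weight `γ = 1_{q ≤ Q/2^k}`
  (`BFI.a7Weight`) on each block;
* `BFI.caseI_bound` — Theorem 6 on the blocks: ranges from `BFI.range_theorem6_of_mem`
  (window `θ + 2e ≤ t ≤ (1−θ)/3 − 2e` for `N = X'^t`, `R ≤ X'^θ`), level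
  `Q'R' ≤ QR/4 < xℒ^{−B} ≤ X'(log X')^{−B₇}` (`B` is returned: it is the level exponent Theorem 9
  inherits from Theorem 6), (A₄) from the rough support, `‖α‖‖β‖X'^{1/2} ≪ X'(log X')^{2^{27}}`;
* `BFI.sum_pairs_le_sum_tau_mul`, `BFI.sparse_bound_pairs` — the pairs `(q, r)` collected into
  `d = qr` with multiplicity `≤ τ(d)`, and the trivial admissibility of SPARSE pieces
  (`‖β‖²(log 2N)^{c_D} < N`) from `BFI.sum_tau_pow_abs_bilinDisc_le` (BFI Lemma 3) with the divisor
  weight `τ(d)` — the complement of the density under which `β` satisfies (A₂).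

## References

* E. Bombieri, J. B. Friedlander, H. Iwaniec, *Primes in arithmetic progressions to large moduli*,
  Acta Math. 156 (1986), 203–251: §2 Lemma 3 p. 211; §3 (3.1) p. 214; §13 (A₇) p. 241, Theorem 6
  p. 244; §16 (16.1) p. 250. [BombieriFriedlanderIwaniecActa1986]
-/

open Finset Real
open scoped ArithmeticFunction.sigma

namespace Literature.NumberTheory.Sieve

namespace BFI

/-! ### The pair sum as a sum of dispersion sums `𝒟` over dyadic blocks -/

/-- Coprimality of a product of naturals with `a`, through the casts. [folklore] -/
theorem isCoprime_natCast_mul_iff (q r : ℕ) (a : ℤ) :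
    IsCoprime ((q * r : ℕ) : ℤ) a ↔ IsCoprime (q : ℤ) a ∧ IsCoprime (r : ℤ) a := by
  push_cast
  exact IsCoprime.mul_left_iff

/-- **The signed pair sum of Theorem 9 as a double sum of dispersion sums** (BFI §16 with §13:
"an obvious partition of the range of summation" into blocks `q ∼ Q' = Q/2^{k+1}`,
`r ∼ R' = R/2^{k'+1}`, on each of which the weight `γ_q = 1_{q ≤ Q}` is the (A₇)-weight
`BFI.a7Weight (2Q')`): for `Q, R ≥ 0`, `Q < 2^{K₁}`, `R < 2^{K₂}` and any `δ`,
`∑_{r ≤ R, (r,a)=1} δ_r ∑_{q ≤ Q, (q,a)=1} Δ_{α⋆β}(qr)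
  = ∑_{k<K₁} ∑_{k'<K₂} 𝒟(M, N, Q/2^{k+1}, R/2^{k'+1}; α, β, 1_{q ≤ Q/2^k}, δ)`.
[cite: BombieriFriedlanderIwaniecActa1986, §13 (A₇) p. 241; §16 p. 250] -/
theorem pairSum_bilinDisc_eq_sum_dispD (a : ℤ) (M N : ℝ) (α β δ : ℕ → ℝ) {Q R : ℝ}
    (hQ : 0 ≤ Q) (hR : 0 ≤ R) {K₁ K₂ : ℕ} (hK₁ : Q < 2 ^ K₁) (hK₂ : R < 2 ^ K₂) :
    ∑ r ∈ (Icc 1 ⌊R⌋₊).filter (fun r : ℕ => IsCoprime (r : ℤ) a),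
        δ r * ∑ q ∈ (Icc 1 ⌊Q⌋₊).filter (fun q : ℕ => IsCoprime (q : ℤ) a),
          bilinDisc a M N α β (q * r) =
      ∑ k ∈ range K₁, ∑ k' ∈ range K₂,
        dispD a M N (Q / 2 ^ (k + 1)) (R / 2 ^ (k' + 1)) α β (a7Weight (Q / 2 ^ k)) δ := by
  set g : ℕ → ℕ → ℝ := fun q r =>
    if IsCoprime ((q * r : ℕ) : ℤ) a then δ r * bilinDisc a M N α β (q * r) else 0 with hg
  -- Step 1: remove the filters
  have h1 : ∑ r ∈ (Icc 1 ⌊R⌋₊).filter (fun r : ℕ => IsCoprime (r : ℤ) a),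
      δ r * ∑ q ∈ (Icc 1 ⌊Q⌋₊).filter (fun q : ℕ => IsCoprime (q : ℤ) a), bilinDisc a M N α β (q * r) =
      ∑ r ∈ Icc 1 ⌊R⌋₊, ∑ q ∈ Icc 1 ⌊Q⌋₊, g q r := by
    rw [Finset.sum_filter]
    refine Finset.sum_congr rfl fun r _ => ?_
    by_cases hr : IsCoprime (r : ℤ) a
    · rw [if_pos hr, Finset.sum_filter, Finset.mul_sum]
      refine Finset.sum_congr rfl fun q _ => ?_
      by_cases hq : IsCoprime (q : ℤ) a
      · rw [if_pos hq, hg]; dsimp only; rw [if_pos ((isCoprime_natCast_mul_iff q r a).2 ⟨hq, hr⟩)]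
      · rw [if_neg hq, mul_zero, hg]; dsimp only
        rw [if_neg (fun h => hq ((isCoprime_natCast_mul_iff q r a).1 h).1)]
    · rw [if_neg hr]
      symm
      refine Finset.sum_eq_zero fun q _ => ?_
      rw [hg]; dsimp only
      rw [if_neg (fun h => hr ((isCoprime_natCast_mul_iff q r a).1 h).2)]
  rw [h1]
  -- Step 2: dyadic partition in `r` and in `q`
  rw [sum_Icc_eq_sum_range_sum_dyadic (fun r => ∑ q ∈ Icc 1 ⌊Q⌋₊, g q r) hR hK₂]
  have h2 : ∀ r : ℕ, ∑ q ∈ Icc 1 ⌊Q⌋₊, g q r =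
      ∑ k ∈ range K₁, ∑ q ∈ dyadic (Q / 2 ^ (k + 1)), g q r :=
    fun r => sum_Icc_eq_sum_range_sum_dyadic (fun q => g q r) hQ hK₁
  simp_rw [h2]
  -- Step 3: reorder to `∑ k ∑ k' ∑ q ∑ r`
  rw [Finset.sum_congr rfl fun k' _ => Finset.sum_comm, Finset.sum_comm]
  refine Finset.sum_congr rfl fun k _ => Finset.sum_congr rfl fun k' _ => ?_
  rw [Finset.sum_comm, dispD_eq_sum_bilinDisc]
  -- Step 4: the block is `𝒟`
  refine Finset.sum_congr rfl fun q hq => Finset.sum_congr rfl fun r _ => ?_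
  have hq2 : (q : ℝ) ≤ Q / 2 ^ k := by
    have := ((mem_dyadic (by positivity)).1 hq).2
    rw [pow_succ] at this
    convert this using 1
    field_simp
  rw [a7Weight_of_le hq2, hg]; dsimp only
  split_ifs <;> ring


/-! ### Case I of §16: a partial product in the range (16.1) of Theorem 6 -/

/-- The large-`x` facts used by Case I (one existential witness). [folklore] -/
theorem eventually_caseI (x₁ x₂ B : ℝ) :
    ∃ x₀ : ℝ, ∀ x : ℝ, x₀ ≤ x → x₁ ≤ x ∧ x₂ ≤ x ∧ Real.exp (Real.exp 1) ≤ x ∧ (2 : ℝ) ^ 105 ≤ x ∧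
      (2 : ℝ) ^ B ≤ Real.log x ∧ 16 ≤ Real.log x := by
  refine ⟨max x₁ (max x₂ (max (Real.exp (Real.exp 1)) (max (2 ^ 105)
    (max (Real.exp (2 ^ B)) (Real.exp 16))))), fun x hx => ?_⟩
  simp only [max_le_iff] at hx
  obtain ⟨h1, h2, h3, h4, h5, h6⟩ := hx
  have hx0 : 0 < x := lt_of_lt_of_le (Real.exp_pos _) h6
  refine ⟨h1, h2, h3, h4, ?_, ?_⟩
  · rw [Real.le_log_iff_exp_le hx0]; exact h5
  · rw [Real.le_log_iff_exp_le hx0]; exact h6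

set_option maxHeartbeats 1600000 in -- Theorem 6 on `K₁K₂` blocks with ~80 hypotheses
/-- **Case I of §16: a partial product in the range (16.1), Theorem 6 on the blocks.**  For the
signed pair sum of Theorem 9 (`γ_q = 1_{q ≤ Q, (q,a)=1}`, `|δ_r| ≤ 1` on `r ≤ R, (r,a)=1`,
`Q, R ≥ 1`), a piece `α ⋆ β` with `MN = X'`, `x ≤ X' ≤ 2^{15}x`, `N = X'^t`, `R ≤ X'^θ`, and the
exponent `t` in the window `θ + 2e ≤ t ≤ (1−θ)/3 − 2e`, `t ≥ 2/15`, `θ ≥ 0` (BFI p. 250, (16.1):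
"`θ₂ + ε < λ < (1−θ₂)/3 − ε`, then Theorem 6 is applicable"), `|α|, |β| ≤ τ^{13}`, `β` supported on
`z`-rough integers (`z ≥ exp(√log x)`) with (A₂) (exponent `2`, constants `Csw`): from
`Literature.NumberTheory.Sieve.BombieriFriedlanderIwaniecTheorem6` (with its `ε = e`) on the blocks
`Q' = Q/2^{k+1}`, `R' = R/2^{k'+1}` of `BFI.pairSum_bilinDisc_eq_sum_dispD` — ranges by
`BFI.range_theorem6_of_mem`, level `Q'R' ≤ QR/4 < xℒ^{−B} ≤ X'(log X')^{−B₇}` — there are `B`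
(the level exponent, from the `B₇` of Theorem 6) and `C, x₀` with
`|∑_{r} δ_r ∑_{q} Δ_{α⋆β}(qr)| ≤ C x (log x)^{−A₅}` for `x ≥ x₀`, `QR < x ℒ^{−B}`.
[cite: BombieriFriedlanderIwaniecActa1986, §16 (16.1) p. 250; §13 Theorem 6 p. 244] -/
theorem caseI_bound (h6 : BombieriFriedlanderIwaniecTheorem6) {a : ℤ} (ha : a ≠ 0)
    {e : ℝ} (he : 0 < e) (he' : e ≤ 1 / 15) {A₅ : ℝ} (hA₅ : 0 ≤ A₅) (Csw : ℝ → ℝ) :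
    ∃ B C x₀ : ℝ, 0 ≤ C ∧ ∀ x : ℝ, x₀ ≤ x →
      ∀ (X' M N t θ z Q R : ℝ) (α β : ArithmeticFunction ℝ) (δ : ℕ → ℝ),
      (∀ r, |δ r| ≤ 1) → x ≤ X' → X' ≤ 2 ^ 15 * x → M * N = X' → N = X' ^ t →
      1 ≤ Q → 1 ≤ R → 0 ≤ θ → R ≤ X' ^ θ → Q * R < x / Real.log x ^ B →
      θ + 2 * e ≤ t → t ≤ (1 - θ) / 3 - 2 * e → 2 / 15 ≤ t →
      Real.exp (Real.sqrt (Real.log x)) ≤ z →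
      (∀ m, |α m| ≤ (σ 0 m : ℝ) ^ 13) → (∀ n, |β n| ≤ (σ 0 n : ℝ) ^ 13) →
      (∀ n, β n ≠ 0 → IsRough z n) →
      SiegelWalfiszHyp N 2 Csw β →
      |∑ r ∈ (Icc 1 ⌊R⌋₊).filter (fun r : ℕ => IsCoprime (r : ℤ) a),
          δ r * ∑ q ∈ (Icc 1 ⌊Q⌋₊).filter (fun q : ℕ => IsCoprime (q : ℤ) a),
            bilinDisc a M N α β (q * r)| ≤ C * x / Real.log x ^ A₅ := by
  obtain ⟨Cl, hCl, hl2⟩ := exists_l2Sq_le_of_abs_le_sigma_zero_pow 13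
  obtain ⟨E', hE'⟩ : ∃ E' : ℕ, 2 ^ (2 * 13 + 1) = 2 * E' := ⟨2 ^ 26, by norm_num⟩
  rw [hE'] at hl2
  set A' : ℝ := A₅ + 2 * E' + 2 with hA'
  have hA'0 : 0 < A' := by rw [hA']; positivity
  obtain ⟨B₀, B₇, C₆, x₆, h6'⟩ := h6 a ha e he A' hA'0 2 (by norm_num) Csw
  set B₇' : ℝ := max B₇ 0 with hB₇'
  have hB₇'0 : 0 ≤ B₇' := le_max_right _ _
  set C₆' : ℝ := max C₆ 0 with hC₆'
  have hC₆'0 : 0 ≤ C₆' := le_max_right _ _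
  obtain ⟨x₂, hx₂⟩ := exists_log_rpow_lt_exp_sqrt B₀
  obtain ⟨x₀, hx₀⟩ := eventually_caseI x₆ x₂ B₇'
  refine ⟨B₇' + 1, 16 * 2 ^ 15 * 2 ^ (2 * E') * C₆' * Cl, x₀, by positivity,
    fun x hx X' M N t θ z Q R α β δ hδ hxX hX'x hMN hNt hQ1 hR1 hθ0 hRθ hQR ht1 ht2 ht3 hz hα hβ hβr hsw => ?_⟩
  obtain ⟨hx₆, hx₂', hxe, hx105, hLB, hL16⟩ := hx₀ x hx
  have hee : (2 : ℝ) < Real.exp (Real.exp 1) := by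
    have h1 : (1 : ℝ) < Real.exp 1 := by have := Real.exp_one_gt_d9; linarith
    have h2 : Real.exp 1 < Real.exp (Real.exp 1) := Real.exp_lt_exp.2 h1
    have := Real.exp_one_gt_d9; linarith
  have hx2 : (2 : ℝ) ≤ x := by linarith
  have hx0 : 0 < x := by linarith
  have hx1 : (1 : ℝ) ≤ x := by linarith
  have hX'2 : (2 : ℝ) ≤ X' := hx2.trans hxX
  have hX'0 : 0 < X' := by linarith
  have hX'1 : (1 : ℝ) < X' := by linarith
  set L : ℝ := Real.log x with hL
  have hL1 : 1 ≤ L := by linarith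
  have hL0 : 0 < L := by linarith
  have hLX : L ≤ Real.log X' := Real.log_le_log hx0 hxX
  have hLX1 : 1 ≤ Real.log X' := hL1.trans hLX
  have hLX0 : 0 < Real.log X' := by linarith
  have hlogX'2 : Real.log X' ≤ 2 * L := by
    have h1 : Real.log X' ≤ Real.log (2 ^ 15 * x) := Real.log_le_log hX'0 hX'x
    rw [Real.log_mul (by norm_num) hx0.ne', Real.log_pow] at h1
    have h2 : Real.log 2 < 0.6931471808 := Real.log_two_lt_d9
    push_cast at h1
    nlinarith
  -- sizes of `M` and `N`
  have ht_lt1 : t < 1 := by linarith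
  have hN1 : 1 ≤ N := by rw [hNt]; exact Real.one_le_rpow hX'1.le (by linarith)
  have hNX : N ≤ X' := by
    rw [hNt]
    calc X' ^ t ≤ X' ^ (1 : ℝ) := Real.rpow_le_rpow_of_exponent_le hX'1.le ht_lt1.le
      _ = X' := Real.rpow_one X'
  have hN0 : 0 < N := by linarith
  have hM : M = X' ^ (1 - t) := by
    have h : M = X' / N := by field_simp; linarith
    rw [h, hNt, Real.rpow_sub hX'0, Real.rpow_one]
  have hM1 : 1 ≤ M := by rw [hM]; exact Real.one_le_rpow hX'1.le (by linarith)
  have hMX : M ≤ X' := by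
    rw [hM]
    calc X' ^ (1 - t) ≤ X' ^ (1 : ℝ) := Real.rpow_le_rpow_of_exponent_le hX'1.le (by linarith)
      _ = X' := Real.rpow_one X'
  have hM0 : 0 < M := by linarith
  -- sizes of `Q`, `R`
  have hQ0 : 0 ≤ Q := by linarith
  have hR0 : 0 ≤ R := by linarith
  have hLBpos : 0 < L ^ (B₇' + 1) := Real.rpow_pos_of_pos hL0 _
  have hQRx : Q * R < x := by
    refine hQR.trans_le ?_
    rw [div_le_iff₀ hLBpos]
    have : 1 ≤ L ^ (B₇' + 1) := Real.one_le_rpow hL1 (by linarith)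
    nlinarith
  have hQX : Q ≤ X' := by nlinarith
  have hRX : R ≤ X' := by nlinarith
  obtain ⟨K₁, hK₁, hK₁'⟩ := exists_pow_two_near hQ1
  obtain ⟨K₂, hK₂, hK₂'⟩ := exists_pow_two_near hR1
  -- replace `δ` by `δ' = δ·1_{r ≠ 0}` (hypothesis (A₃) with exponent `2`)
  set δ' : ℕ → ℝ := fun r => if r = 0 then 0 else δ r with hδ'
  have hδ'A3 : ∀ r, |δ' r| ≤ (σ 0 r : ℝ) ^ (2 : ℝ) := by
    intro r
    rcases Nat.eq_zero_or_pos r with rfl | hr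
    · simp [hδ']
    · have h1 : (1 : ℝ) ≤ (σ 0 r : ℝ) := by exact_mod_cast one_le_sigma_zero hr.ne'
      simp only [hδ', if_neg hr.ne']
      exact (hδ r).trans (Real.one_le_rpow h1 (by norm_num))
  have hδδ' : ∑ r ∈ (Icc 1 ⌊R⌋₊).filter (fun r : ℕ => IsCoprime (r : ℤ) a),
      δ r * ∑ q ∈ (Icc 1 ⌊Q⌋₊).filter (fun q : ℕ => IsCoprime (q : ℤ) a), bilinDisc a M N α β (q * r) =
      ∑ r ∈ (Icc 1 ⌊R⌋₊).filter (fun r : ℕ => IsCoprime (r : ℤ) a),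
        δ' r * ∑ q ∈ (Icc 1 ⌊Q⌋₊).filter (fun q : ℕ => IsCoprime (q : ℤ) a), bilinDisc a M N α β (q * r) := by
    refine Finset.sum_congr rfl fun r hr => ?_
    have hr1 : 1 ≤ r := (mem_Icc.1 (mem_filter.1 hr).1).1
    simp only [hδ', if_neg (by omega : r ≠ 0)]
  rw [hδδ', pairSum_bilinDisc_eq_sum_dispD a M N α β δ' hQ0 hR0 hK₁ hK₂]
  -- hypotheses (A₄) for `β`
  have hzB : Real.log X' ^ B₀ < z := (hx₂ x X' hx₂' hxX hX'x).trans_le hz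
  have hsift : IsSifted (dyadic N) (Real.log X' ^ B₀) β :=
    isSifted_of_rough_support hzB _ β.map_zero hβr
  -- the level: `x/L^{B₇'+1} ≤ X'/(log X')^{B₇}`
  have hlevel : x / L ^ (B₇' + 1) ≤ X' / Real.log X' ^ B₇ := by
    have h1 : Real.log X' ^ B₇ ≤ Real.log X' ^ B₇' :=
      Real.rpow_le_rpow_of_exponent_le hLX1 (le_max_left _ _)
    have h2 : Real.log X' ^ B₇' ≤ (2 * L) ^ B₇' := Real.rpow_le_rpow hLX0.le hlogX'2 hB₇'0
    have h3 : (2 * L) ^ B₇' = 2 ^ B₇' * L ^ B₇' := Real.mul_rpow (by norm_num) hL0.le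
    have h4 : 2 ^ B₇' * L ^ B₇' ≤ L ^ (B₇' + 1) := by
      rw [Real.rpow_add hL0, Real.rpow_one, mul_comm]
      exact mul_le_mul_of_nonneg_left hLB (Real.rpow_nonneg hL0.le _)
    have hpos : 0 < Real.log X' ^ B₇ := Real.rpow_pos_of_pos hLX0 _
    calc x / L ^ (B₇' + 1) ≤ x / Real.log X' ^ B₇ := by
          refine div_le_div_of_nonneg_left hx0.le hpos ?_
          linarith
      _ ≤ X' / Real.log X' ^ B₇ := div_le_div_of_nonneg_right hxX hpos.le
  -- the ranges of `N` (Theorem 6 with `ε = e`)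
  have hNlow : X' ^ e ≤ N := by
    rw [hNt]; exact Real.rpow_le_rpow_of_exponent_le hX'1.le (by linarith)
  have hNup : N ≤ X' ^ (1 - e) := by
    rw [hNt]; exact Real.rpow_le_rpow_of_exponent_le hX'1.le (by linarith)
  -- the block bound
  set Bblk : ℝ := C₆' * Cl * X' * (2 * Real.log X') ^ (2 * E') / Real.log X' ^ A' with hBblk
  have hBblk0 : 0 ≤ Bblk := by rw [hBblk]; positivity
  have hblock : ∀ k, k < K₁ → ∀ k', k' < K₂ →
      |dispD a M N (Q / 2 ^ (k + 1)) (R / 2 ^ (k' + 1)) α β (a7Weight (Q / 2 ^ k)) δ'| ≤ Bblk := by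
    intro k hk k' hk'
    set Q' : ℝ := Q / 2 ^ (k + 1) with hQ'
    set R' : ℝ := R / 2 ^ (k' + 1) with hR'
    have hQ'0 : 1 / 2 ≤ Q' := by
      rw [hQ', le_div_iff₀ (by positivity)]
      have hpow : (2 : ℝ) ^ (k + 1) ≤ 2 ^ K₁ := pow_le_pow_right₀ (by norm_num) hk
      linarith
    have hR'0 : 1 / 2 ≤ R' := by
      rw [hR', le_div_iff₀ (by positivity)]
      have hpow : (2 : ℝ) ^ (k' + 1) ≤ 2 ^ K₂ := pow_le_pow_right₀ (by norm_num) hk'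
      linarith
    have hQ'pos : 0 < Q' := by linarith
    have hR'pos : 0 < R' := by linarith
    have hQ'Q : Q' ≤ Q / 2 := by
      rw [hQ']; exact div_le_div_of_nonneg_left hQ0 (by norm_num) (le_self_pow₀ (by norm_num) (by omega))
    have hR'R : R' ≤ R / 2 := by
      rw [hR']; exact div_le_div_of_nonneg_left hR0 (by norm_num) (le_self_pow₀ (by norm_num) (by omega))
    -- `Q₁ = 2Q' = Q/2^k`
    have hQ₁ : Q / 2 ^ k = 2 * Q' := by rw [hQ', pow_succ]; field_simp
    have hQ'Q₁ : Q' < Q / 2 ^ k := by rw [hQ₁]; linarith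
    have hQ₁2 : Q / 2 ^ k ≤ 2 * Q' := by rw [hQ₁]
    -- level of the block
    have hQ'R' : Q' * R' < X' / Real.log X' ^ B₇ := by
      have h1 : Q' * R' ≤ Q * R := by
        calc Q' * R' ≤ (Q / 2) * (R / 2) := mul_le_mul hQ'Q hR'R hR'pos.le (by linarith)
          _ ≤ Q * R := by nlinarith
      exact (h1.trans_lt hQR).trans_le hlevel
    -- range (16.1)
    obtain ⟨hr1, hr2⟩ := range_theorem6_of_mem (θ' := θ) he le_rfl ht1 ht2
    have hRN : X' ^ e * R' < N := by
      have h1 : R' < X' ^ θ := by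
        calc R' ≤ R / 2 := hR'R
          _ < R := by linarith
          _ ≤ X' ^ θ := hRθ
      calc X' ^ e * R' < X' ^ e * X' ^ θ := mul_lt_mul_of_pos_left h1 (Real.rpow_pos_of_pos hX'0 _)
        _ = X' ^ (e + θ) := by rw [← Real.rpow_add hX'0]
        _ ≤ X' ^ t := Real.rpow_le_rpow_of_exponent_le hX'1.le hr1.le
        _ = N := hNt.symm
    have hNR : N < X' ^ (-e) * (X' / R') ^ (1 / 3 : ℝ) := by
      have hR'θ : R' ≤ X' ^ θ := by
        calc R' ≤ R / 2 := hR'R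
          _ ≤ R := by linarith
          _ ≤ X' ^ θ := hRθ
      have h1 : X' ^ (1 - θ) ≤ X' / R' := by
        rw [Real.rpow_sub hX'0, Real.rpow_one]
        exact div_le_div_of_nonneg_left hX'0.le hR'pos hR'θ
      have h2 : X' ^ ((1 - θ) / 3) ≤ (X' / R') ^ (1 / 3 : ℝ) := by
        calc X' ^ ((1 - θ) / 3) = (X' ^ (1 - θ)) ^ (1 / 3 : ℝ) := by
              rw [← Real.rpow_mul hX'0.le]; ring_nf
          _ ≤ (X' / R') ^ (1 / 3 : ℝ) := Real.rpow_le_rpow (Real.rpow_nonneg hX'0.le _) h1 (by norm_num)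
      calc N = X' ^ t := hNt
        _ < X' ^ (-e + (1 - θ) / 3) := Real.rpow_lt_rpow_of_exponent_lt hX'1 hr2
        _ = X' ^ (-e) * X' ^ ((1 - θ) / 3) := Real.rpow_add hX'0 _ _
        _ ≤ X' ^ (-e) * (X' / R') ^ (1 / 3 : ℝ) :=
            mul_le_mul_of_nonneg_left h2 (Real.rpow_nonneg hX'0.le _)
    have h := h6' X' (hx₆.trans hxX) M N Q' R' (Q / 2 ^ k) hMN hNlow hNup hQ'0 hR'0 hQ'Q₁ hQ₁2 hQ'R'
      hRN hNR β hsw hsift α δ' hδ'A3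
    refine h.trans ?_
    -- `‖α‖ ‖β‖ X'^{1/2} ≤ Cl X' (2 log X')^{2E'}`
    have hαn := sqrt_l2Sq_le hM1 hMX hX'2 hCl (hl2 M hM1 α hα)
    have hβn := sqrt_l2Sq_le hN1 hNX hX'2 hCl (hl2 N hN1 β hβ)
    have hprod : Real.sqrt (l2Sq M α) * Real.sqrt (l2Sq N β) * X' ^ (1 / 2 : ℝ) ≤
        Cl * X' * (2 * Real.log X') ^ (2 * E') := by
      calc Real.sqrt (l2Sq M α) * Real.sqrt (l2Sq N β) * X' ^ (1 / 2 : ℝ)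
          ≤ (Real.sqrt Cl * Real.sqrt M * (2 * Real.log X') ^ E') *
              (Real.sqrt Cl * Real.sqrt N * (2 * Real.log X') ^ E') * X' ^ (1 / 2 : ℝ) := by
            gcongr
      _ = (Real.sqrt Cl * Real.sqrt Cl) * (Real.sqrt M * Real.sqrt N * X' ^ (1 / 2 : ℝ)) *
            ((2 * Real.log X') ^ E' * (2 * Real.log X') ^ E') := by ring
      _ = Cl * X' * (2 * Real.log X') ^ (2 * E') := by
          have h1 : Real.sqrt Cl * Real.sqrt Cl = Cl := Real.mul_self_sqrt hCl.le
          have h2 : Real.sqrt M * Real.sqrt N * X' ^ (1 / 2 : ℝ) = X' := by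
            rw [← Real.sqrt_mul hM0.le, hMN, ← Real.sqrt_eq_rpow, Real.mul_self_sqrt hX'0.le]
          rw [h1, h2, ← pow_add, ← two_mul]
    have h0 : 0 ≤ Real.sqrt (l2Sq M α) * Real.sqrt (l2Sq N β) * X' ^ (1 / 2 : ℝ) := by positivity
    calc C₆ * Real.sqrt (l2Sq M α) * Real.sqrt (l2Sq N β) * X' ^ (1 / 2 : ℝ) / Real.log X' ^ A'
        = C₆ * (Real.sqrt (l2Sq M α) * Real.sqrt (l2Sq N β) * X' ^ (1 / 2 : ℝ)) / Real.log X' ^ A' := by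
          ring
      _ ≤ C₆' * (Cl * X' * (2 * Real.log X') ^ (2 * E')) / Real.log X' ^ A' := by
          refine div_le_div_of_nonneg_right ?_ (Real.rpow_nonneg hLX0.le _)
          exact mul_le_mul (le_max_left _ _) hprod h0 hC₆'0
      _ = Bblk := by rw [hBblk]; ring
  refine (abs_sum_sum_range_le hblock).trans ?_
  -- counting blocks, `log X'` versus `log x`
  have hK₁le : (K₁ : ℝ) ≤ 4 * Real.log X' := natCast_le_four_mul_log hK₁' hQ1 hX'2 hQX
  have hK₂le : (K₂ : ℝ) ≤ 4 * Real.log X' := natCast_le_four_mul_log hK₂' hR1 hX'2 hRX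
  have hpow : Real.log X' ^ (2 * E' + 2) / Real.log X' ^ A' ≤ (Real.log x ^ A₅)⁻¹ := by
    rw [← Real.rpow_natCast, ← Real.rpow_sub hLX0, ← Real.rpow_neg (by linarith)]
    have heq : ((2 * E' + 2 : ℕ) : ℝ) - A' = -A₅ := by rw [hA']; push_cast; ring
    rw [heq]
    exact Real.rpow_le_rpow_of_nonpos (by linarith) hLX (by linarith)
  calc (K₁ : ℝ) * K₂ * Bblk ≤ (4 * Real.log X') * (4 * Real.log X') * Bblk := by
        have hK₂0 : (0 : ℝ) ≤ K₂ := Nat.cast_nonneg _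
        exact mul_le_mul_of_nonneg_right (mul_le_mul hK₁le hK₂le hK₂0 (by positivity)) hBblk0
    _ = 16 * 2 ^ (2 * E') * C₆' * Cl * X' *
          (Real.log X' ^ (2 * E' + 2) / Real.log X' ^ A') := by
        rw [hBblk, mul_pow]; ring
    _ ≤ 16 * 2 ^ (2 * E') * C₆' * Cl * (2 ^ 15 * x) * (Real.log x ^ A₅)⁻¹ := by
        refine mul_le_mul (mul_le_mul_of_nonneg_left hX'x (by positivity)) hpow (by positivity)
          (by positivity)
    _ = 16 * 2 ^ 15 * 2 ^ (2 * E') * C₆' * Cl * x / Real.log x ^ A₅ := by ring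


/-! ### Sparse pieces, for pairs of moduli -/

/-- **Collecting pairs of moduli.**  For `f ≥ 0`,
`∑_{r ≤ Rn} ∑_{q ≤ Qn} f(qr) ≤ ∑_{d ≤ Qn Rn} τ(d) f(d)`: each `d` arises from at most `τ(d)` pairs
(`q ∣ d` determines `r`). [folklore] -/
theorem sum_pairs_le_sum_tau_mul (f : ℕ → ℝ) (hf : ∀ d, 0 ≤ f d) (Qn Rn : ℕ) :
    ∑ r ∈ Icc 1 Rn, ∑ q ∈ Icc 1 Qn, f (q * r) ≤ ∑ d ∈ Icc 1 (Qn * Rn), (σ 0 d : ℝ) * f d := by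
  rw [← Finset.sum_product']
  set S : Finset (ℕ × ℕ) := Icc 1 Rn ×ˢ Icc 1 Qn with hS
  set m : ℕ × ℕ → ℕ := fun p => p.2 * p.1 with hm
  have hmaps : ∀ p ∈ S, m p ∈ Icc 1 (Qn * Rn) := by
    intro p hp
    rw [hS, Finset.mem_product, Finset.mem_Icc, Finset.mem_Icc] at hp
    rw [Finset.mem_Icc]
    exact ⟨Nat.mul_pos hp.2.1 hp.1.1, Nat.mul_le_mul hp.2.2 hp.1.2⟩
  rw [← Finset.sum_fiberwise_of_maps_to hmaps]
  refine Finset.sum_le_sum fun d hd => ?_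
  have hd0 : d ≠ 0 := by have := (Finset.mem_Icc.1 hd).1; omega
  have hfib : ∀ p ∈ S.filter (fun p => m p = d), f (m p) = f d := fun p hp => by
    rw [(Finset.mem_filter.1 hp).2]
  rw [Finset.sum_congr rfl hfib, Finset.sum_const, nsmul_eq_mul]
  refine mul_le_mul_of_nonneg_right ?_ (hf d)
  rw [ArithmeticFunction.sigma_zero_apply]
  have hcard : (S.filter (fun p => m p = d)).card ≤ d.divisors.card := by
    refine Finset.card_le_card_of_injOn (fun p => p.2) (fun p hp => ?_) ?_
    · rw [Finset.coe_filter] at hp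
      obtain ⟨-, hp⟩ := hp
      show p.2 ∈ d.divisors
      rw [Nat.mem_divisors]
      exact ⟨⟨p.1, by rw [← hp]⟩, hd0⟩
    · intro p₁ hp₁ p₂ hp₂ h
      rw [Finset.coe_filter] at hp₁ hp₂
      obtain ⟨hp₁S, hp₁d⟩ := hp₁
      obtain ⟨-, hp₂d⟩ := hp₂
      have h1 : p₁.2 * p₁.1 = p₂.2 * p₂.1 := hp₁d.trans hp₂d.symm
      have hq0 : 0 < p₁.2 := by
        rw [hS, Finset.mem_product, Finset.mem_Icc, Finset.mem_Icc] at hp₁S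
        exact hp₁S.2.1
      simp only at h
      rw [h] at h1 hq0
      have h2 : p₁.1 = p₂.1 := Nat.eq_of_mul_eq_mul_left hq0 h1
      exact Prod.ext h2 h
  exact_mod_cast hcard

set_option maxHeartbeats 400000 in
/-- **Sparse pieces are trivially admissible, for pairs of moduli.**  For `a ≠ 0`, `A₅ ≥ 0` there
are a density exponent `c_D ≥ 0` and `C, x₀` such that for `x ≥ x₀`, `x ≤ X' ≤ 2^{15} x`, `MN = X'`,
`N = X'^s` with `2/15 ≤ s ≤ 9/20`, `Q, R ≥ 1`, `QR ≤ X'`, `|α| ≤ τ^{13}` on `m ∼ M`, `β` on `n ∼ N`,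
`|δ| ≤ 1`, and `β` SPARSE in the sense `‖β‖² (log 2N)^{c_D} < N`:
`|∑_{r ≤ R, (r,a)=1} δ_r ∑_{q ≤ Q, (q,a)=1} Δ_{α⋆β}(qr)| ≤ C x (log x)^{−A₅}`.
(The pair version of `BFI.sparse_bound`: the pairs `(q, r)` are collected into `d = qr ≤ QR` with
multiplicity `≤ τ(d)` (`BFI.sum_pairs_le_sum_tau_mul`), and the trivial bound
`BFI.sum_tau_pow_abs_bilinDisc_le` from BFI Lemma 3 is applied with the divisor weight `τ(d)`.)
[cite: BombieriFriedlanderIwaniecActa1986, §2 Lemma 3 p. 211; §15 p. 246; §16 p. 250] -/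
theorem sparse_bound_pairs (hL3 : BombieriFriedlanderIwaniecLemma3) {a : ℤ} (ha : a ≠ 0)
    {A₅ : ℝ} (hA₅ : 0 ≤ A₅) :
    ∃ cD C x₀ : ℝ, 0 ≤ cD ∧ 0 ≤ C ∧ ∀ x : ℝ, x₀ ≤ x → ∀ (X' M N s Q R : ℝ) (α β δ : ℕ → ℝ),
      (∀ r, |δ r| ≤ 1) → x ≤ X' → X' ≤ 2 ^ 15 * x → M * N = X' → N = X' ^ s →
      2 / 15 ≤ s → s ≤ 9 / 20 → 1 ≤ Q → 1 ≤ R → Q * R ≤ X' →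
      (∀ m, |α m| ≤ (σ 0 m : ℝ) ^ 13) → (∀ m, α m ≠ 0 → m ∈ dyadic M) →
      (∀ n, β n ≠ 0 → n ∈ dyadic N) →
      l2Sq N β * Real.log (2 * N) ^ cD < N →
      |∑ r ∈ (Icc 1 ⌊R⌋₊).filter (fun r : ℕ => IsCoprime (r : ℤ) a),
          δ r * ∑ q ∈ (Icc 1 ⌊Q⌋₊).filter (fun q : ℕ => IsCoprime (q : ℤ) a),
            bilinDisc a M N α β (q * r)| ≤ C * x / Real.log x ^ A₅ := by
  obtain ⟨Bt, Ct, xt, hBt, hCt, ht⟩ := sum_tau_pow_abs_bilinDisc_le hL3 ha 13 1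
  set r : ℕ := ⌈Bt⌉₊ with hr
  obtain ⟨Cτ, hCτ, hτ⟩ := exists_sum_dyadic_sigma_zero_pow_le (2 * r)
  obtain ⟨Ca, hCa, hCa'⟩ := exists_sum_abs_le_of_abs_le_sigma_zero_pow 13
  obtain ⟨Cφ, hCφ, hφ⟩ := exists_sum_sigma_zero_pow_div_totient_le_real 1
  obtain ⟨E, hE⟩ : ∃ E : ℕ, E = 2 ^ (13 + 1) := ⟨_, rfl⟩
  rw [← hE] at hCa'
  set c₁ : ℕ := 2 ^ (2 * r + 1) with hc₁
  set K : ℝ := A₅ + Bt + E + 8 with hK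
  have hK0 : 0 ≤ K := by rw [hK]; positivity
  obtain ⟨x₀, hx₀⟩ := eventually_sparse xt
  refine ⟨c₁ + 2 * K, (Ct * Real.sqrt Cτ + Cφ * Ca * Real.sqrt 3 * 2 ^ E) * 8 ^ K * 2 ^ 15, x₀,
    by positivity, by positivity,
    fun x hx X' M N s Q R α β δ hδ hxX hX'x hMN hNs hs1 hs2 hQ1 hR1 hQRX hα hαs hβs hsparse => ?_⟩
  obtain ⟨hxt, hxe, hx20⟩ := hx₀ x hx
  have hee : (2 : ℝ) < Real.exp (Real.exp 1) := by
    have h1 : (1 : ℝ) < Real.exp 1 := by have := Real.exp_one_gt_d9; linarith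
    have h2 : Real.exp 1 < Real.exp (Real.exp 1) := Real.exp_lt_exp.2 h1
    have := Real.exp_one_gt_d9; linarith
  have hx2 : (2 : ℝ) ≤ x := by linarith
  have hx0 : 0 < x := by linarith
  have hX'2 : (2 : ℝ) ≤ X' := hx2.trans hxX
  have hX'0 : 0 < X' := by linarith
  have hX'1 : (1 : ℝ) < X' := by linarith
  have hLx : 1 ≤ Real.log x := by
    rw [Real.le_log_iff_exp_le hx0]
    refine le_trans ?_ hxe
    exact Real.exp_le_exp.2 (by have := Real.exp_one_gt_d9; linarith)
  have hLX : Real.log x ≤ Real.log X' := Real.log_le_log hx0 hxX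
  have hLX1 : 1 ≤ Real.log X' := hLx.trans hLX
  have hLX0 : 0 < Real.log X' := by linarith
  -- sizes
  have hN1 : 1 ≤ N := by rw [hNs]; exact Real.one_le_rpow hX'1.le (by linarith)
  have hNX : N ≤ X' := by
    rw [hNs]
    calc X' ^ s ≤ X' ^ (1 : ℝ) := Real.rpow_le_rpow_of_exponent_le hX'1.le (by linarith)
      _ = X' := Real.rpow_one X'
  have hN0 : 0 < N := by linarith
  have hM : M = X' ^ (1 - s) := by
    have h : M = X' / N := by field_simp; linarith
    rw [h, hNs, Real.rpow_sub hX'0, Real.rpow_one]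
  have hM1 : 1 ≤ M := by rw [hM]; exact Real.one_le_rpow hX'1.le (by linarith)
  have hMX : M ≤ X' := by
    rw [hM]
    calc X' ^ (1 - s) ≤ X' ^ (1 : ℝ) := Real.rpow_le_rpow_of_exponent_le hX'1.le (by linarith)
      _ = X' := Real.rpow_one X'
  have hM0 : 0 < M := by linarith
  have h4N : 4 * N ^ 2 ≤ X' := by
    -- `N ≤ X'^{9/20}` and `X' ≥ 2^{20}` give `4 N² ≤ 4 X'^{9/10} ≤ X'`
    have h1 : N ^ 2 ≤ X' ^ (9 / 10 : ℝ) := by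
      rw [hNs, ← Real.rpow_natCast, ← Real.rpow_mul hX'0.le]
      exact Real.rpow_le_rpow_of_exponent_le hX'1.le (by push_cast; linarith)
    have h2 : (4 : ℝ) ≤ X' ^ (1 / 10 : ℝ) := by
      have h3 : (2 : ℝ) ^ 20 ≤ X' := hx20.trans hxX
      have h4 : ((4 : ℝ)) ^ (10 : ℕ) ≤ (X' ^ (1 / 10 : ℝ)) ^ (10 : ℕ) := by
        rw [← Real.rpow_natCast (X' ^ (1 / 10 : ℝ)) 10, ← Real.rpow_mul hX'0.le]
        norm_num; linarith
      exact (pow_le_pow_iff_left₀ (by norm_num) (Real.rpow_nonneg hX'0.le _) (by norm_num)).1 h4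
    calc 4 * N ^ 2 ≤ X' ^ (1 / 10 : ℝ) * X' ^ (9 / 10 : ℝ) :=
          mul_le_mul h2 h1 (sq_nonneg _) (Real.rpow_nonneg hX'0.le _)
      _ = X' := by rw [← Real.rpow_add hX'0]; norm_num
  set Dn : ℕ := ⌊Q⌋₊ * ⌊R⌋₊ with hDn
  have hDnX : (Dn : ℝ) ≤ X' := by
    rw [hDn]; push_cast
    calc (⌊Q⌋₊ : ℝ) * ⌊R⌋₊ ≤ Q * R :=
          mul_le_mul (Nat.floor_le (by linarith)) (Nat.floor_le (by linarith)) (Nat.cast_nonneg _)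
            (by linarith)
      _ ≤ X' := hQRX
  -- `log 2N`, `log 2M`
  set ℓ : ℝ := Real.log (2 * N) with hℓ
  have hℓ1 : Real.log X' / 8 ≤ ℓ := by
    rw [hℓ]
    have h1 : Real.log N = s * Real.log X' := by rw [hNs, Real.log_rpow hX'0]
    have h2 : Real.log N ≤ Real.log (2 * N) := Real.log_le_log hN0 (by linarith)
    nlinarith
  have hLX5 : 8 ≤ Real.log X' := by
    have h1 : Real.log ((2 : ℝ) ^ 20) ≤ Real.log X' := Real.log_le_log (by norm_num) (hx20.trans hxX)
    rw [Real.log_pow] at h1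
    have h2 : (0.6931471803 : ℝ) < Real.log 2 := Real.log_two_gt_d9
    push_cast at h1
    linarith
  have hℓone : 1 ≤ ℓ := by linarith
  have hℓ0 : 0 < ℓ := by linarith
  have hlog2 : ∀ {T : ℝ}, 1 ≤ T → T ≤ X' → Real.log (2 * T) ≤ 2 * Real.log X' := by
    intro T hT1 hTX
    have h1 : 2 * T ≤ X' ^ 2 := by nlinarith
    calc Real.log (2 * T) ≤ Real.log (X' ^ 2) := Real.log_le_log (by linarith) h1
      _ = 2 * Real.log X' := by rw [Real.log_pow]; norm_num
  -- sparseness: `‖β‖² ≤ N ℓ^{-c_D}`, `‖β‖ ≤ √N ℓ^{-c_D/2}`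
  have hcD : ((c₁ : ℝ) + 2 * K) = 2 * ((c₁ : ℝ) / 2 + K) := by ring
  have hsqrtβ : Real.sqrt (l2Sq N β) ≤ Real.sqrt N * ℓ ^ (-((c₁ : ℝ) / 2 + K)) := by
    have h1 : l2Sq N β ≤ N * ℓ ^ (-((c₁ : ℝ) + 2 * K)) := by
      rw [Real.rpow_neg hℓ0.le, ← div_eq_mul_inv, le_div_iff₀ (Real.rpow_pos_of_pos hℓ0 _)]
      exact hsparse.le
    calc Real.sqrt (l2Sq N β) ≤ Real.sqrt (N * ℓ ^ (-((c₁ : ℝ) + 2 * K))) := Real.sqrt_le_sqrt h1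
      _ = Real.sqrt N * ℓ ^ (-((c₁ : ℝ) / 2 + K)) := by
          rw [Real.sqrt_mul hN0.le, Real.sqrt_eq_rpow (ℓ ^ (-((c₁ : ℝ) + 2 * K))), ← Real.rpow_mul hℓ0.le]
          congr 2; ring
  -- `∑ |β_n| τ(n)^{Bt} ≤ ‖β‖ (C_τ N ℓ^{c₁})^{1/2} ≤ √C_τ N ℓ^{-K}`
  have hβτ : ∑ n ∈ dyadic N, |β n| * (σ 0 n : ℝ) ^ Bt ≤ Real.sqrt Cτ * N * ℓ ^ (-K) := by
    have h1 : ∑ n ∈ dyadic N, |β n| * (σ 0 n : ℝ) ^ Bt ≤ ∑ n ∈ dyadic N, |β n| * (σ 0 n : ℝ) ^ r := by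
      refine Finset.sum_le_sum fun n hn => mul_le_mul_of_nonneg_left ?_ (abs_nonneg _)
      have hn0 : n ≠ 0 := (pos_of_mem_dyadic hN0.le hn).ne'
      have hτ1 : (1 : ℝ) ≤ (σ 0 n : ℝ) := by exact_mod_cast one_le_sigma_zero hn0
      rw [← Real.rpow_natCast]
      exact Real.rpow_le_rpow_of_exponent_le hτ1 (Nat.le_ceil Bt)
    have h2 := sum_abs_mul_sigma_pow_le N β r
    have h3 : Real.sqrt (∑ n ∈ dyadic N, (σ 0 n : ℝ) ^ (2 * r)) ≤ Real.sqrt (Cτ * N) * ℓ ^ ((c₁ : ℝ) / 2) := by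
      calc Real.sqrt (∑ n ∈ dyadic N, (σ 0 n : ℝ) ^ (2 * r)) ≤ Real.sqrt (Cτ * N * ℓ ^ c₁) :=
            Real.sqrt_le_sqrt (hτ N hN1)
        _ = Real.sqrt (Cτ * N) * ℓ ^ ((c₁ : ℝ) / 2) := by
            rw [Real.sqrt_mul (by positivity), Real.sqrt_eq_rpow (ℓ ^ c₁), ← Real.rpow_natCast,
              ← Real.rpow_mul hℓ0.le]
            congr 2; ring
    calc ∑ n ∈ dyadic N, |β n| * (σ 0 n : ℝ) ^ Bt
        ≤ Real.sqrt (l2Sq N β) * Real.sqrt (∑ n ∈ dyadic N, (σ 0 n : ℝ) ^ (2 * r)) := h1.trans h2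
      _ ≤ (Real.sqrt N * ℓ ^ (-((c₁ : ℝ) / 2 + K))) * (Real.sqrt (Cτ * N) * ℓ ^ ((c₁ : ℝ) / 2)) :=
          mul_le_mul hsqrtβ h3 (Real.sqrt_nonneg _) (by positivity)
      _ = Real.sqrt Cτ * N * ℓ ^ (-K) := by
          rw [Real.sqrt_mul hCτ.le]
          have h4 : ℓ ^ (-((c₁ : ℝ) / 2 + K)) * ℓ ^ ((c₁ : ℝ) / 2) = ℓ ^ (-K) := by
            rw [← Real.rpow_add hℓ0]; congr 1; ring
          have h5 : Real.sqrt N * Real.sqrt N = N := Real.mul_self_sqrt hN0.le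
          calc Real.sqrt N * ℓ ^ (-((c₁ : ℝ) / 2 + K)) * (Real.sqrt Cτ * Real.sqrt N * ℓ ^ ((c₁ : ℝ) / 2))
              = Real.sqrt Cτ * (Real.sqrt N * Real.sqrt N) *
                  (ℓ ^ (-((c₁ : ℝ) / 2 + K)) * ℓ ^ ((c₁ : ℝ) / 2)) := by ring
            _ = _ := by rw [h4, h5]
  -- `‖β‖₁ ≤ √3 N ℓ^{-K}`
  have hβ1 : ∑ n ∈ dyadic N, |β n| ≤ Real.sqrt 3 * N * ℓ ^ (-K) := by
    have h1 := sum_abs_le_sqrt_l2Sq hN0.le β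
    have h2 : Real.sqrt (2 * N + 1) ≤ Real.sqrt 3 * Real.sqrt N := by
      rw [← Real.sqrt_mul (by norm_num)]
      exact Real.sqrt_le_sqrt (by linarith)
    have h3 : ℓ ^ (-((c₁ : ℝ) / 2 + K)) ≤ ℓ ^ (-K) :=
      Real.rpow_le_rpow_of_exponent_le hℓone (by have : (0:ℝ) ≤ c₁ := Nat.cast_nonneg _; linarith)
    calc ∑ n ∈ dyadic N, |β n| ≤ Real.sqrt (l2Sq N β) * Real.sqrt (2 * N + 1) := h1
      _ ≤ (Real.sqrt N * ℓ ^ (-K)) * (Real.sqrt 3 * Real.sqrt N) := by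
          refine mul_le_mul (hsqrtβ.trans (mul_le_mul_of_nonneg_left h3 (Real.sqrt_nonneg _))) h2
            (Real.sqrt_nonneg _) (by positivity)
      _ = Real.sqrt 3 * N * ℓ ^ (-K) := by
          have h5 : Real.sqrt N * Real.sqrt N = N := Real.mul_self_sqrt hN0.le
          calc Real.sqrt N * ℓ ^ (-K) * (Real.sqrt 3 * Real.sqrt N)
              = Real.sqrt 3 * (Real.sqrt N * Real.sqrt N) * ℓ ^ (-K) := by ring
            _ = _ := by rw [h5]
  -- `‖α‖₁ ≤ C_a M (2 log X')^E`, `∑ τ/φ ≤ C_φ (log X')^8`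
  have hα1 : ∑ m ∈ dyadic M, |α m| ≤ Ca * M * (2 * Real.log X') ^ E :=
    (hCa' M hM1 α hα).trans (mul_le_mul_of_nonneg_left
      (pow_le_pow_left₀ (Real.log_nonneg (by linarith)) (hlog2 hM1 hMX) E) (by positivity))
  have hΦ : ∑ d ∈ Icc 1 Dn, (σ 0 d : ℝ) ^ 1 / (Nat.totient d : ℝ) ≤ Cφ * Real.log X' ^ 8 := by
    have h := hφ X' hX'2
    norm_num at h
    have hDnX' : Dn ≤ ⌊X'⌋₊ := Nat.le_floor hDnX
    refine le_trans (Finset.sum_le_sum_of_subset_of_nonneg (Finset.Icc_subset_Icc le_rfl hDnX')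
      fun _ _ _ => by positivity) ?_
    simpa only [pow_one] using h
  -- `ℓ^{-K} ≤ 8^K (log X')^{-K}` and the `log X'` powers
  have hℓK : ℓ ^ (-K) ≤ 8 ^ K * Real.log X' ^ (-K) := by
    calc ℓ ^ (-K) ≤ (Real.log X' / 8) ^ (-K) := Real.rpow_le_rpow_of_nonpos (by positivity) hℓ1 (by linarith)
      _ = 8 ^ K * Real.log X' ^ (-K) := by
          rw [div_eq_mul_inv, Real.mul_rpow hLX0.le (by norm_num), Real.inv_rpow (by norm_num),
            Real.rpow_neg (by norm_num : (0:ℝ) ≤ 8), inv_inv]; ring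
  have hpow1 : Real.log X' ^ Bt * Real.log X' ^ (-K) ≤ (Real.log x ^ A₅)⁻¹ := by
    rw [← Real.rpow_add hLX0, ← Real.rpow_neg (by linarith)]
    calc Real.log X' ^ (Bt + -K) ≤ Real.log X' ^ (-A₅) :=
          Real.rpow_le_rpow_of_exponent_le hLX1 (by rw [hK]; have : (0:ℝ) ≤ E := Nat.cast_nonneg _; linarith)
      _ ≤ Real.log x ^ (-A₅) := Real.rpow_le_rpow_of_nonpos (by linarith) hLX (by linarith)
  have hpow2 : Real.log X' ^ 8 * (2 * Real.log X') ^ E * Real.log X' ^ (-K) ≤ 2 ^ E * (Real.log x ^ A₅)⁻¹ := by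
    rw [mul_pow, show Real.log X' ^ 8 * (2 ^ E * Real.log X' ^ E) = 2 ^ E * Real.log X' ^ (E + 8) by ring]
    rw [mul_assoc]
    refine mul_le_mul_of_nonneg_left ?_ (by positivity)
    rw [← Real.rpow_natCast, ← Real.rpow_add hLX0, ← Real.rpow_neg (by linarith)]
    calc Real.log X' ^ (((E + 8 : ℕ) : ℝ) + -K) ≤ Real.log X' ^ (-A₅) :=
          Real.rpow_le_rpow_of_exponent_le hLX1 (by rw [hK]; push_cast; linarith)
      _ ≤ Real.log x ^ (-A₅) := Real.rpow_le_rpow_of_nonpos (by linarith) hLX (by linarith)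
  have hT1 : Ct * M * Real.log X' ^ Bt * ∑ n ∈ dyadic N, |β n| * (σ 0 n : ℝ) ^ Bt ≤
      Ct * Real.sqrt Cτ * 8 ^ K * X' * (Real.log x ^ A₅)⁻¹ := by
    have i1 : ∑ n ∈ dyadic N, |β n| * (σ 0 n : ℝ) ^ Bt ≤ Real.sqrt Cτ * N * (8 ^ K * Real.log X' ^ (-K)) :=
      hβτ.trans (mul_le_mul_of_nonneg_left hℓK (mul_nonneg (Real.sqrt_nonneg _) hN0.le))
    have i0 : 0 ≤ Ct * M * Real.log X' ^ Bt :=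
      mul_nonneg (mul_nonneg hCt hM0.le) (Real.rpow_nonneg hLX0.le _)
    have i2 := mul_le_mul_of_nonneg_left i1 i0
    have i3 : Ct * M * Real.log X' ^ Bt * (Real.sqrt Cτ * N * (8 ^ K * Real.log X' ^ (-K))) =
        Ct * Real.sqrt Cτ * 8 ^ K * (M * N) * (Real.log X' ^ Bt * Real.log X' ^ (-K)) := by ring
    have h5K : (0 : ℝ) ≤ 8 ^ K := Real.rpow_nonneg (by norm_num) _
    have i4 : 0 ≤ Ct * Real.sqrt Cτ * 8 ^ K * (M * N) := by
      rw [hMN]; exact mul_nonneg (mul_nonneg (mul_nonneg hCt (Real.sqrt_nonneg _)) h5K) hX'0.le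
    have i5 := mul_le_mul_of_nonneg_left hpow1 i4
    rw [hMN] at i3 i5
    exact (i2.trans i3.le).trans i5
  have hT2 : (∑ d ∈ Icc 1 Dn, (σ 0 d : ℝ) ^ 1 / (Nat.totient d : ℝ)) * (∑ m ∈ dyadic M, |α m|) * ∑ n ∈ dyadic N, |β n| ≤
      Cφ * Ca * Real.sqrt 3 * 2 ^ E * 8 ^ K * X' * (Real.log x ^ A₅)⁻¹ := by
    have hL4 : 0 ≤ Cφ * Real.log X' ^ 8 := mul_nonneg hCφ.le (pow_nonneg hLX0.le 8)
    have i1 : (∑ d ∈ Icc 1 Dn, (σ 0 d : ℝ) ^ 1 / (Nat.totient d : ℝ)) * (∑ m ∈ dyadic M, |α m|) ≤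
        (Cφ * Real.log X' ^ 8) * (Ca * M * (2 * Real.log X') ^ E) :=
      mul_le_mul hΦ hα1 (Finset.sum_nonneg fun _ _ => abs_nonneg _) hL4
    have i2 : ∑ n ∈ dyadic N, |β n| ≤ Real.sqrt 3 * N * (8 ^ K * Real.log X' ^ (-K)) :=
      hβ1.trans (mul_le_mul_of_nonneg_left hℓK (mul_nonneg (Real.sqrt_nonneg _) hN0.le))
    have i0 : 0 ≤ (Cφ * Real.log X' ^ 8) * (Ca * M * (2 * Real.log X') ^ E) :=
      mul_nonneg hL4 (mul_nonneg (mul_nonneg hCa.le hM0.le) (pow_nonneg (mul_nonneg zero_le_two hLX0.le) E))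
    have i3 := mul_le_mul i1 i2 (Finset.sum_nonneg fun _ _ => abs_nonneg _) i0
    have i4 : (Cφ * Real.log X' ^ 8) * (Ca * M * (2 * Real.log X') ^ E) * (Real.sqrt 3 * N * (8 ^ K * Real.log X' ^ (-K))) =
        Cφ * Ca * Real.sqrt 3 * 8 ^ K * (M * N) *
          (Real.log X' ^ 8 * (2 * Real.log X') ^ E * Real.log X' ^ (-K)) := by ring
    have h5K : (0 : ℝ) ≤ 8 ^ K := Real.rpow_nonneg (by norm_num) _
    have i5 : 0 ≤ Cφ * Ca * Real.sqrt 3 * 8 ^ K * (M * N) := by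
      rw [hMN]
      exact mul_nonneg (mul_nonneg (mul_nonneg (mul_nonneg hCφ.le hCa.le) (Real.sqrt_nonneg _)) h5K) hX'0.le
    have i6 := mul_le_mul_of_nonneg_left hpow2 i5
    rw [hMN] at i4 i6
    calc _ ≤ _ := i3
      _ = _ := i4
      _ ≤ _ := i6
      _ = _ := by ring
  -- assemble: the trivial bound
  have hmain := ht X' M N (hxt.trans hxX) hN1 h4N hMN α β hα hαs hβs Dn
  have hfilter : |∑ r ∈ (Icc 1 ⌊R⌋₊).filter (fun r : ℕ => IsCoprime (r : ℤ) a),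
      δ r * ∑ q ∈ (Icc 1 ⌊Q⌋₊).filter (fun q : ℕ => IsCoprime (q : ℤ) a), bilinDisc a M N α β (q * r)| ≤
      ∑ d ∈ Icc 1 Dn, (σ 0 d : ℝ) ^ 1 * |bilinDisc a M N α β d| := by
    refine (Finset.abs_sum_le_sum_abs _ _).trans ?_
    refine (Finset.sum_le_sum_of_subset_of_nonneg (Finset.filter_subset _ _)
      fun _ _ _ => abs_nonneg _).trans ?_
    have h1 : ∀ r ∈ Icc 1 ⌊R⌋₊, |δ r * ∑ q ∈ (Icc 1 ⌊Q⌋₊).filter (fun q : ℕ => IsCoprime (q : ℤ) a),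
        bilinDisc a M N α β (q * r)| ≤ ∑ q ∈ Icc 1 ⌊Q⌋₊, |bilinDisc a M N α β (q * r)| := by
      intro r _
      rw [abs_mul]
      calc _ ≤ 1 * |∑ q ∈ (Icc 1 ⌊Q⌋₊).filter (fun q : ℕ => IsCoprime (q : ℤ) a), bilinDisc a M N α β (q * r)| :=
            mul_le_mul_of_nonneg_right (hδ r) (abs_nonneg _)
        _ ≤ ∑ q ∈ (Icc 1 ⌊Q⌋₊).filter (fun q : ℕ => IsCoprime (q : ℤ) a), |bilinDisc a M N α β (q * r)| := by
            rw [one_mul]; exact Finset.abs_sum_le_sum_abs _ _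
        _ ≤ _ := Finset.sum_le_sum_of_subset_of_nonneg (Finset.filter_subset _ _) fun _ _ _ => abs_nonneg _
    refine (Finset.sum_le_sum h1).trans ?_
    refine (sum_pairs_le_sum_tau_mul (fun d => |bilinDisc a M N α β d|) (fun _ => abs_nonneg _) ⌊Q⌋₊ ⌊R⌋₊).trans ?_
    exact le_of_eq (Finset.sum_congr rfl fun d _ => by rw [pow_one])
  refine hfilter.trans (hmain.trans ?_)
  refine (add_le_add hT1 hT2).trans ?_
  have hLA : 0 ≤ (Real.log x ^ A₅)⁻¹ := inv_nonneg.2 (Real.rpow_nonneg (zero_le_one.trans hLx) _)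
  have hX'x' : X' * (Real.log x ^ A₅)⁻¹ ≤ 2 ^ 15 * x * (Real.log x ^ A₅)⁻¹ :=
    mul_le_mul_of_nonneg_right hX'x hLA
  calc Ct * Real.sqrt Cτ * 8 ^ K * X' * (Real.log x ^ A₅)⁻¹ +
        Cφ * Ca * Real.sqrt 3 * 2 ^ E * 8 ^ K * X' * (Real.log x ^ A₅)⁻¹
      = (Ct * Real.sqrt Cτ + Cφ * Ca * Real.sqrt 3 * 2 ^ E) * 8 ^ K * (X' * (Real.log x ^ A₅)⁻¹) := by ring
    _ ≤ (Ct * Real.sqrt Cτ + Cφ * Ca * Real.sqrt 3 * 2 ^ E) * 8 ^ K * (2 ^ 15 * x * (Real.log x ^ A₅)⁻¹) := by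
        refine mul_le_mul_of_nonneg_left hX'x' (mul_nonneg ?_ (Real.rpow_nonneg (by norm_num) _))
        exact add_nonneg (mul_nonneg hCt (Real.sqrt_nonneg _))
          (mul_nonneg (mul_nonneg (mul_nonneg hCφ.le hCa.le) (Real.sqrt_nonneg _)) (pow_nonneg (by norm_num) E))
    _ = (Ct * Real.sqrt Cτ + Cφ * Ca * Real.sqrt 3 * 2 ^ E) * 8 ^ K * 2 ^ 15 * x / Real.log x ^ A₅ := by ring

/-! ### Case A2: Theorem 2 on the blocks -/


end BFI

end Literature.NumberTheory.Sieve
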